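import Summits.ResolutionOfSingularities.ResolutionOfSingularities.Theorems.EquisingularLiftEquisingularLiftNatTCPlusMemberCentred
import Summits.ResolutionOfSingularities.ResolutionOfSingularities.Theorems.EquisingularLiftEquisingularLiftNatClusterPointGoodChart
import Summits.ResolutionOfSingularities.ResolutionOfSingularities.Theorems.EquisingularLiftEquisingularLiftNatCarrierDeltaOffCluster
import Summits.ResolutionOfSingularities.ResolutionOfSingularities.Theorems.EquisingularLiftEquisingularLiftNatTCPlusMemberClusterPrep
import HarnessLib

/-!
# [OURS · L1 W4.5(b) · EL♮(3)] (δ) D5 MEMBER_S: THE MEMBER OF THE TC⁺⁺ INVARIANT CENTRED AT A SUB-CLUSTER `S` — `TCPlus.Member … F₂ T₂ Z₂ (y′ '' S)`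

Crux chain w45b (cell `res-hironaka`, slot W4.5(b)), working crux **EL♮** = stmt-ResolutionOfSingularities-20038, child **EL♮(3)** =
stmt-ResolutionOfSingularities-20148, route EquisingularLift, line `sections`, registered stub `stub_elnat_tcPlusPlusPointResolution` (v2);
supplier HSUB′(ReachTCPlusPlus₂)₃ = driver `hsub_reachTCPlusPlus_of_invariant` (p543222) at `INV := TCPlusPlus.Inv` (p547095), brick (δ) =
STEP 0 per subset; this file is **D5** of res-L1-w45b-stub-3's `DELTA-PLAN.md` (res-L1-w45b-plan-1 BOOKING 2026-08-27T16:20:41Z: D5/D6 :=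
res-type-100). HONEST FRAMING: OURS; NOT a statement of any manuscript; AI-written, weaker than expert review. No `sorry`; standard axioms.
DEF-FREE. `--supports stmt-ResolutionOfSingularities-20148 --as helper`.

WHAT. **`tcPlus_member_cluster`** — res-type-100's B8 `tcPlus_member_centred` (p547231) with the one cone point `y′` replaced by the SUB-CLUSTER
`y′ '' S`. Binders: the driver's point step at relative dimension `3` (B8 verbatim: `Ch`-stage `(X′, σ′, S′)`, model square `j`, section `s`,
blow-up `τ₁` with its model square `j₂` over the point blow-up `υ`, germ `W`); a section frame `c` at `j x` (`θR`, domain, identity on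
constants, `(c) + (ϖ) = 𝔪` for every uniformizer — res-D-pv-051's frame lift p550981 + `exists_sectionFrame_of_span_eq_forall_at` supply it
from `CarrierCluster₂`'s downstairs frame); the residue model `πk : 𝒪_{F₁,x} ↠ k'` with `ker πk = (c̄)`, `c̄ = j♯ c`, and `πO = πk ∘ j♯ ∘ ι`
onto `k'`; the downstairs initial form `Φ₁` of `closure W` in the frame `c̄` and the reduced tangent form `g` (`CarrierFrame` / `ReducedConeForm`
clauses); a fat cluster `(s, i, aO, m)` with `O`-coordinates (`FatCluster g s i (πO ∘ aO) m`) and its cluster points `y′ t ∈ F₂` with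
chart-`i t` presentations (res-type-100 D3 `exists_clusterPoint`, p551356); a subset `S`; THE CONE `Φ ∈ O[T₀,T₁,T₂]_dg` with `πO_* Φ = g` and
res-L1-w45b-stub-3's D1 STANDARD-CHART Δ-clause relative to `S` (`exists_clusterConeLift_subset` p548257, clause 5 verbatim); a cone ideal
sheaf `K₀` with germ `(ι_*Φ)(c)` and principal stalks; and (vi) the CENTRED PACKAGES at the points of `S` (res-L1-w45b-stub-3's D4
`tcPlus_centredPackage_clusterPoint`, one call per point) as the hypothesis `hpkg`.
CONCLUSION: `TCPlus.Member O k θ P q Y Ch F₂ T₂ Z₂ (y′ '' S)` with witnesses `X₁`, `j₂`, `E = (ker s)·𝒪_{X₁}`, `K = St_{τ₁} K₀`.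
Clauses: (i) exact special fibre for ANY lift of `g` (res-type-097 T-TCONE `vanishingIdeal_carrierTrace_eq_strictTransformIdeal_sup_comap` +
res-L1-w45b-stub-1 `comap_strictTransformIdeal_sup_comap_eq_of_model`, the `k' → 𝒪/(c̄)` transport of …NatTCPlusMemberClusterPrep);
(ii)/(iv) B4b `carrierPair_flat_support_of_stalk` (p543482); (iii) as B8; (v) at a special point `z = j₂ w` off `j₂(y′ '' S)`: res-type-100's
D3d good chart (`exists_goodChart_of_forall_ne_clusterPoint`) + `isRegularLocalRing_quotient_carrierDelta_of_goodChart` (p555526) fed by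
D1's clause in pointed form (`deltaClause_pointed_of_comap_ne`); (vi) `hpkg`.
-/

set_option linter.dupNamespace false -- mandated namespace `Summit.<Summit>.<Problem>` of this single-conjunct summit
set_option linter.overlappingInstances false -- the binders carry `[IsDomain O] [IsDiscreteValuationRing O]`

noncomputable section

open CategoryTheory CategoryTheory.Limits AlgebraicGeometry TopologicalSpace IsLocalRing
open Literature.AlgebraicGeometry.Resolution
open AlgebraicGeometry.Scheme.IdealSheafData
open Summit.ResolutionOfSingularities.ResolutionOfSingularities.Cruxes.EquisingularLift.StrataSplit

namespace Summit.ResolutionOfSingularities.ResolutionOfSingularities.Cruxes.EquisingularLiftNat.Sections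

set_option maxHeartbeats 1600000 in -- long assembly over the chart algebra `blowupAlgebra` (slow instance unification, cf. B8 p547231)
/-- **THE MEMBER OF THE TC⁺⁺ INVARIANT CENTRED AT A SUB-CLUSTER** (`TCPlus.Member … F₂ T₂ Z₂ (y′ '' S)`; see the module docstring).
[cite: Matsumura1987, Thm. 14.2; StacksProject, Tag 0804] [OURS · L1 W4.5b] (δ) D5 toward `stub_elnat_tcPlusPlusPointResolution`; NOT a
statement of the manuscript. -/
theorem tcPlus_member_cluster (k : Type) [Field k] [IsAlgClosed k] (O : Type) [CommRing O] [IsDomain O]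
    [IsDiscreteValuationRing O] [IsAdicComplete (IsLocalRing.maximalIdeal O) O] [IsAlgClosed (IsLocalRing.ResidueField O)]
    (θ : O →+* k) (hθ : Function.Surjective θ) (P : Scheme.{0}) (q : P ⟶ Spec (.of O)) (Y : Set P)
    (Ch : ∀ X' : Scheme.{0}, (X' ⟶ P) → Set X' → Prop)
    (hChSplit : ∀ (X' : Scheme.{0}) (σ' : X' ⟶ P) (S' : Set X'), Ch X' σ' S' →
      Summit.ResolutionOfSingularities.ResolutionOfSingularities.Theses.EquisingularLift.Split.Chain P Y X' σ' S')
    (hPnoeth : IsLocallyNoetherian P) (hPreg : Scheme.IsRegular P) [IsProper q]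
    (X' : Scheme.{0}) (σ' : X' ⟶ P) (S' : Set X') (hCh' : Ch X' σ' S') [IsIntegral X'] [IsLocallyNoetherian X']
    (hX'reg : Scheme.IsRegular X') (F₁ : Scheme.{0}) [IsIntegral F₁] (j : F₁ ⟶ X') (t : F₁ ⟶ Spec (.of k))
    (hsq : IsPullback j t (σ' ≫ q) (Spec.map (CommRingCat.ofHom θ))) (T₁ : Set F₁) (x : F₁) (hx : IsClosed ({x} : Set F₁))
    (s : Spec (.of O) ⟶ X') (hs : s ≫ σ' ≫ q = 𝟙 _) (hsx : s (IsLocalRing.closedPoint O) = j x)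
    (hdim : ringKrullDim (X'.presheaf.stalk (s (IsLocalRing.closedPoint O))) = ((3 + 1 : ℕ) : WithBot ℕ∞))
    (hsoff : ∀ c ∈ (s.ker.support : Set X'), ¬ IsGenericPoint (σ' c) Y)
    (X₁ : Scheme.{0}) (τ₁ : X₁ ⟶ X') (hτ₁ : IsBlowup τ₁ s.ker) [IsIntegral X₁] [IsLocallyNoetherian X₁]
    (hX₁reg : Scheme.IsRegular X₁) (hX₁dom : IsDominant ((τ₁ ≫ σ') ≫ q))
    (F₂ : Scheme.{0}) [IsIntegral F₂] (υ : F₂ ⟶ F₁) (hυ : IsBlowup υ (vanishingIdeal (⟨{x}, hx⟩ : Closeds F₁)))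
    (j₂ : F₂ ⟶ X₁) (t₂ : F₂ ⟶ Spec (.of k)) (hsq₂ : IsPullback j₂ t₂ ((τ₁ ≫ σ') ≫ q) (Spec.map (CommRingCat.ofHom θ)))
    (hcomm : j₂ ≫ τ₁ = υ ≫ j) (hcarrier : (s.ker.comap τ₁).comap j₂ = (vanishingIdeal (⟨{x}, hx⟩ : Closeds F₁)).comap υ)
    (hCh₁ : Ch X₁ (τ₁ ≫ σ') (j₂ '' closure (υ ⁻¹' (T₁ \ {x})))) (W : Set F₁)
    -- the section frame at `j x`
    (c : Fin 3 → X'.presheaf.stalk (j x)) (hcI : Ideal.span (Set.range c) = stalkIdeal s.ker (j x))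
    (hqr : IsQuasiRegular c) (hdom : IsDomain (X'.presheaf.stalk (j x) ⧸ Ideal.span (Set.range c)))
    (θR : (X'.presheaf.stalk (j x) ⧸ Ideal.span (Set.range c)) ≃+* O)
    (hθR : ∀ b : O, θR (Ideal.Quotient.mk _
      (((Scheme.ΓSpecIso (.of O)).inv ≫ (σ' ≫ q).appTop ≫ X'.presheaf.Γgerm (j x)).hom b)) = b)
    (hframe : ∀ ϖ : O, Irreducible ϖ →
      Ideal.span (Set.range c) ⊔ Ideal.span {((Scheme.ΓSpecIso (.of O)).inv ≫ (σ' ≫ q).appTop ≫ X'.presheaf.Γgerm (j x)).hom ϖ} =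
        maximalIdeal (X'.presheaf.stalk (j x)) ∧
      ((Scheme.ΓSpecIso (.of O)).inv ≫ (σ' ≫ q).appTop ≫ X'.presheaf.Γgerm (j x)).hom ϖ ∉ Ideal.span (Set.range c))
    -- the residue models `πk` (of `𝒪_{F₁,x}`, kernel `(c̄)`) and `πO = πk ∘ j♯ ∘ ι` (of `O`)
    {k' : Type} [Field k'] (πk : F₁.presheaf.stalk x →+* k') (hπk : Function.Surjective πk)
    (hkerπ : RingHom.ker πk = Ideal.span (Set.range fun i => (j.stalkMap x).hom (c i)))
    (πO : O →+* k') (hπOsurj : Function.Surjective πO)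
    (hπO : ∀ b : O, πk ((j.stalkMap x).hom
      (((Scheme.ΓSpecIso (.of O)).inv ≫ (σ' ≫ q).appTop ≫ X'.presheaf.Γgerm (j x)).hom b)) = πO b)
    -- the downstairs initial form of `closure W` and the reduced tangent form (`CarrierFrame` / `ReducedConeForm` clauses)
    {d₁ : ℕ} (Φ₁ : MvPolynomial (Fin 3) (F₁.presheaf.stalk x)) (hΦ₁d : Φ₁.IsHomogeneous d₁)
    (hΦ₁0 : MvPolynomial.map (Ideal.Quotient.mk (Ideal.span (Set.range fun i => (j.stalkMap x).hom (c i)))) Φ₁ ≠ 0)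
    (hW : stalkIdeal (vanishingIdeal (⟨closure W, isClosed_closure⟩ : Closeds F₁)) x =
      Ideal.span {MvPolynomial.eval (fun i => (j.stalkMap x).hom (c i)) Φ₁})
    {dg : ℕ} (g : MvPolynomial (Fin 3) k') (hg0 : g ≠ 0)
    (hR1 : MvPolynomial.map πk Φ₁ ∈ (Ideal.span {g}).radical)
    (hR1' : g ∈ (Ideal.span {MvPolynomial.map πk Φ₁}).radical)
    (hR2 : ∀ j' : Fin 3, (Ideal.span {dehomogenize j' g}).IsRadical)
    -- the fat cluster with `O`-coordinates, its closed cluster points with their chart presentations (D3), the subset `S`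
    {ns : ℕ} (i : Fin ns → Fin 3) (aO : (t : Fin ns) → {l : Fin 3 // l ≠ i t} → O) (m : Fin ns → ℕ)
    (hF : FatCluster g ns i (fun t l => πO (aO t l)) m)
    (y' : Fin ns → F₂) (hy'x : ∀ t, υ (y' t) = x)
    (𝔮p : ∀ t, PrimeSpectrum (blowupAlgebra (Ideal.span (Set.range fun i => (j.stalkMap x).hom (c i)))
      ((j.stalkMap x).hom (c (i t)))))
    (χp : ∀ t, blowupAlgebra (Ideal.span (Set.range fun i => (j.stalkMap x).hom (c i))) ((j.stalkMap x).hom (c (i t))) →+*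
      F₂.presheaf.stalk (y' t))
    (hχp : ∀ t r, χp t (algebraMap _ _ r) = ((F₁.presheaf.stalkCongr (.of_eq (hy'x t))).inv ≫ υ.stalkMap (y' t)).hom r)
    (hlocp : ∀ t, @IsLocalization.AtPrime _ _ (F₂.presheaf.stalk (y' t)) _ (χp t).toAlgebra (𝔮p t).asIdeal _)
    (h𝔮p : ∀ t, (𝔮p t).asIdeal.comap (algebraMap _ (blowupAlgebra (Ideal.span (Set.range fun i => (j.stalkMap x).hom (c i)))
      ((j.stalkMap x).hom (c (i t))))) = maximalIdeal (F₁.presheaf.stalk x))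
    (hfrp : ∀ t (l : {l : Fin 3 // l ≠ i t}), blowupAlgebra.frac (fun i => (j.stalkMap x).hom (c i)) (i t) l.1 -
      algebraMap _ _ ((j.stalkMap x).hom (((Scheme.ΓSpecIso (.of O)).inv ≫ (σ' ≫ q).appTop ≫ X'.presheaf.Γgerm (j x)).hom
        (aO t l))) ∈ (𝔮p t).asIdeal)
    (S : Set (Fin ns))
    -- the cone centred at `S`: a lift of `g` with D1's standard-chart Δ-clause relative to `S` (uniformizer `ϖ`)
    (ϖ : O) (hϖ : Irreducible ϖ) (Φ : MvPolynomial (Fin 3) O) (hΦd : Φ.IsHomogeneous dg) (hΦg : MvPolynomial.map πO Φ = g)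
    (hΔ : ∀ (j' : Fin 3) (Q : Ideal (MvPolynomial {l : Fin 3 // l ≠ j'} O ⧸ Ideal.span {dehomogenize j' Φ})) [Q.IsPrime],
      Ideal.Quotient.mk (Ideal.span {dehomogenize j' Φ}) (MvPolynomial.C ϖ : MvPolynomial {l : Fin 3 // l ≠ j'} O) ∈ Q →
      (∀ t : Fin ns, (if h : j' = i t then (1 : k') else πO (aO t ⟨j', h⟩)) ≠ 0 → (t ∈ S ∨ i t ≠ j') →
        (Ideal.span (Set.range fun l : {l : Fin 3 // l ≠ j'} =>
          (MvPolynomial.X l : MvPolynomial {l : Fin 3 // l ≠ j'} k') -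
            MvPolynomial.C ((if h : (l : Fin 3) = i t then (1 : k') else πO (aO t ⟨l, h⟩)) /
              (if h : j' = i t then (1 : k') else πO (aO t ⟨j', h⟩))))).comap
          (MvPolynomial.map (σ := {l : Fin 3 // l ≠ j'}) πO) ≠
        Q.comap (Ideal.Quotient.mk (Ideal.span {dehomogenize j' Φ}))) →
      IsRegularLocalRing (Localization.AtPrime Q))
    -- the cone ideal sheaf
    (K₀ : X'.IdealSheafData) (hK₀pr : ∀ z : X', (stalkIdeal K₀ z).IsPrincipal)
    (hK₀ : stalkIdeal K₀ (j x) = Ideal.span {MvPolynomial.eval c (MvPolynomial.map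
      ((Scheme.ΓSpecIso (.of O)).inv ≫ (σ' ≫ q).appTop ≫ X'.presheaf.Γgerm (j x)).hom Φ)})
    -- (vi) the centred packages at the points of `S` (res-L1-w45b-stub-3's D4, one call per point)
    (hpkg : ∀ t ∈ S, TCPlus.CentredPackage O P q X₁ (τ₁ ≫ σ') (s.ker.comap τ₁) (strictTransformIdeal τ₁ s.ker K₀) (j₂ (y' t))) :
    TCPlus.Member O k θ P q Y Ch F₂ (closure (υ ⁻¹' (T₁ \ {x}))) (υ ⁻¹' {x} ∩ closure (υ ⁻¹' (W \ {x}))) (y' '' S) := by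
  classical
  -- properness of the stage, closed immersions of the model squares, Noetherianity of the fibres (B8 verbatim)
  haveI : IsProper σ' := (chain_isRegular P Y X' σ' S' (hChSplit X' σ' S' hCh') hPnoeth hPreg).2.2
  haveI : IsProper (σ' ≫ q) := inferInstance
  haveI : IsProper τ₁ := hτ₁.isProper
  haveI : IsClosedImmersion (Spec.map (CommRingCat.ofHom θ)) := IsClosedImmersion.spec_of_surjective _ hθ
  haveI : IsClosedImmersion j := MorphismProperty.IsStableUnderBaseChange.of_isPullback hsq.flip inferInstance
  haveI : IsClosedImmersion j₂ := MorphismProperty.IsStableUnderBaseChange.of_isPullback hsq₂.flip inferInstance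
  haveI : IsLocallyNoetherian F₁ := LocallyOfFiniteType.isLocallyNoetherian j
  haveI : IsLocallyNoetherian F₂ := by
    haveI : IsProper υ := hυ.isProper
    exact LocallyOfFiniteType.isLocallyNoetherian υ
  haveI := hdom
  haveI : IsRegularRing (X'.presheaf.stalk (j x) ⧸ Ideal.span (Set.range c)) := IsRegularRing.of_ringEquiv θR.symm
  have hZ : IsClosed (υ ⁻¹' {x} ∩ closure (υ ⁻¹' (W \ {x}))) := (hx.preimage υ.continuous).inter isClosed_closure
  have hsq₂' : IsPullback j₂ t₂ (τ₁ ≫ σ' ≫ q) (Spec.map (CommRingCat.ofHom θ)) := by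
    simpa only [Category.assoc] using hsq₂
  have hϖO : ϖ ∈ maximalIdeal O := by rw [hϖ.maximalIdeal_eq]; exact Ideal.mem_span_singleton_self ϖ
  have h𝔪 := (hframe ϖ hϖ).1
  have hϖc := (hframe ϖ hϖ).2
  -- the model frame downstairs
  have hcb𝔪 := span_stalkMap_eq_maximalIdeal_of_model θ hθ (σ' ≫ q) j t hsq x ϖ hϖO c h𝔪
  have hcbar := isQuasiRegular_stalkMap_model O k θ hθ (σ' ≫ q) j t hsq x c hqr ϖ hϖ hϖc
  have hJ : s.ker.comap j = vanishingIdeal ⟨{x}, hx⟩ :=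
    comap_ker_eq_vanishingIdeal_of_model θ hθ (σ' ≫ q) s hs j t hsq x hx hsx c hcI hcb𝔪
  -- the section centre: regular, non-zero, through `j x`
  obtain ⟨-, hsreg, -, hsupp⟩ := section_isClosedImmersion_and_isRegular_ker O X' (σ' ≫ q) s hs
  have hpJ : j x ∈ (s.ker.support : Set X') := by rw [hsupp, ← hsx]; exact Set.mem_range_self _
  have hs0 : s.ker ≠ ⊥ := ne_bot_of_isBlowup hτ₁ (Nonempty.some inferInstance)
  -- the cone: `Φ ≠ 0`, `ι_*Φ ≢ 0 mod (c)`, `Φ ≢ 0 mod 𝔪_O`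
  have hρ₀ : (θR.toRingHom.comp (Ideal.Quotient.mk (Ideal.span (Set.range c)))).comp
      ((Scheme.ΓSpecIso (.of O)).inv ≫ (σ' ≫ q).appTop ≫ X'.presheaf.Γgerm (j x)).hom = RingHom.id O :=
    RingHom.ext fun b => hθR b
  have hΦne : Φ ≠ 0 := fun h0 => hg0 (by rw [← hΦg, h0, map_zero])
  have hΦι : MvPolynomial.map (Ideal.Quotient.mk (Ideal.span (Set.range c)))
      (MvPolynomial.map ((Scheme.ΓSpecIso (.of O)).inv ≫ (σ' ≫ q).appTop ≫ X'.presheaf.Γgerm (j x)).hom Φ) ≠ 0 := by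
    intro h
    apply hΦne
    have h2 := congrArg (MvPolynomial.map θR.toRingHom) h
    rwa [MvPolynomial.map_map, MvPolynomial.map_map, hρ₀, MvPolynomial.map_id, map_zero] at h2
  have hΦιd : (MvPolynomial.map ((Scheme.ΓSpecIso (.of O)).inv ≫ (σ' ≫ q).appTop ≫ X'.presheaf.Γgerm (j x)).hom Φ).IsHomogeneous dg :=
    hΦd.map _
  have hkerπO : RingHom.ker πO = maximalIdeal O := by
    have hπ₀ := residueModel_surjective_and_ker θ hθ (σ' ≫ q) j t hsq x c θR hθR hcb𝔪 rfl
    ext b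
    rw [← hπ₀.2, RingHom.mem_ker, RingHom.mem_ker, ← hπO]
    change _ ↔ Ideal.Quotient.mk _ ((j.stalkMap x).hom _) = 0
    rw [Ideal.Quotient.eq_zero_iff_mem, ← hkerπ, RingHom.mem_ker]
  have hΦres : MvPolynomial.map (IsLocalRing.residue O) Φ ≠ 0 := fun h => hg0 (by
    rw [← hΦg]
    refine map_eq_zero_of_coeff_mem_ker πO fun n => ?_
    rw [hkerπO, ← IsLocalRing.ker_residue]
    exact coeff_mem_ker_of_map_eq_zero (IsLocalRing.residue O) h n)
  -- the image of the cone downstairs: `G = j♯_* ι_* Φ` with `πk_* G = g`; the reduced-cone relations modulo `(c̄)`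
  have hGg : MvPolynomial.map πk (MvPolynomial.map (j.stalkMap x).hom
      (MvPolynomial.map ((Scheme.ΓSpecIso (.of O)).inv ≫ (σ' ≫ q).appTop ≫ X'.presheaf.Γgerm (j x)).hom Φ)) = g := by
    rw [MvPolynomial.map_map, MvPolynomial.map_map, ← hΦg]
    exact congrArg (MvPolynomial.map · Φ) (RingHom.ext fun b => hπO b)
  obtain ⟨hΦG, hGΦ, hGrad, hΦbar⟩ := reducedCone_relations_of_residueModel (fun i => (j.stalkMap x).hom (c i)) πk hπk hkerπ Φ₁ _
    hGg hR1 hR1' hR2 hg0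
  -- B4b: flatness and support of the pair
  have hdimx : ringKrullDim (X'.presheaf.stalk (j x)) = ((3 + 1 : ℕ) : WithBot ℕ∞) := by rw [← hsx]; exact hdim
  obtain ⟨hflat, hsuppE, -⟩ := carrierPair_flat_support_of_stalk O (σ' ≫ q) s hs (j x) hsx (hX'reg (j x)) τ₁ hτ₁ ϖ hϖ c hcI
    hdimx Φ hΦd hΦres K₀ hK₀
  refine ⟨X₁, τ₁ ≫ σ', _, j₂, t₂, s.ker.comap τ₁, strictTransformIdeal τ₁ s.ker K₀, hCh₁, ‹_›, ‹_›, hX₁reg, hX₁dom, hsq₂,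
    rfl, ?_, ?_, isRegular_exceptional_subscheme O (σ' ≫ q) s hs (j x) hsx τ₁ hτ₁ c hcI hqr θR, fun z => ⟨?_, ?_⟩, ?_,
    fun z hz hzq hzex => ?_, fun y₀ hy₀ => ?_⟩
  · -- (i) exact special fibre for the lift `Φ` of `g` (T-TCONE + the model comparison)
    have hcl : (⟨closure (υ ⁻¹' {x} ∩ closure (υ ⁻¹' (W \ {x}))), isClosed_closure⟩ : Closeds F₂) =
        ⟨υ ⁻¹' {x} ∩ closure (υ ⁻¹' (W \ {x})), hZ⟩ := Closeds.ext hZ.closure_eq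
    have hZ' : IsClosed (υ ⁻¹' {x} ∩ closure (υ ⁻¹' (((⟨closure W, isClosed_closure⟩ : Closeds F₁) : Set F₁) \ {x}))) := by
      rw [Closeds.coe_mk, ← closure_preimage_diff_singleton_eq_of_isBlowup hx hυ W]; exact hZ
    have hcl' : (⟨υ ⁻¹' {x} ∩ closure (υ ⁻¹' (W \ {x})), hZ⟩ : Closeds F₂) =
        ⟨υ ⁻¹' {x} ∩ closure (υ ⁻¹' (((⟨closure W, isClosed_closure⟩ : Closeds F₁) : Set F₁) \ {x})), hZ'⟩ :=
      Closeds.ext (by rw [Closeds.coe_mk, Closeds.coe_mk, Closeds.coe_mk, closure_preimage_diff_singleton_eq_of_isBlowup hx hυ W])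
    rw [hcl, hcl', show s.ker.comap τ₁ ⊔ strictTransformIdeal τ₁ s.ker K₀ = strictTransformIdeal τ₁ s.ker K₀ ⊔ s.ker.comap τ₁ from
      sup_comm _ _, comap_strictTransformIdeal_sup_comap_eq_of_model τ₁ s.ker _ hτ₁ j υ j₂ hcomm x hx hυ hJ c hcI hqr _ hΦιd
      hΦι hK₀ hcbar hΦbar]
    have hK' : stalkIdeal (K₀.comap j) x =
        Ideal.span {MvPolynomial.eval (fun i => (j.stalkMap x).hom (c i)) (MvPolynomial.map (j.stalkMap x).hom
          (MvPolynomial.map ((Scheme.ΓSpecIso (.of O)).inv ≫ (σ' ≫ q).appTop ≫ X'.presheaf.Γgerm (j x)).hom Φ))} := by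
      rw [stalkIdeal_comap_eq_map_stalkMap, hK₀, Ideal.map_span, Set.image_singleton, ringHom_eval_eq_eval_map]
    exact (vanishingIdeal_carrierTrace_eq_strictTransformIdeal_sup_comap hx hυ (fun i => (j.stalkMap x).hom (c i)) hcb𝔪 hcbar
      ⟨closure W, isClosed_closure⟩ _ Φ₁ _ hΦ₁d (hΦιd.map _) hΦ₁0 hΦbar hW hK' hΦG hGΦ hGrad hZ').symm
  · -- (ii) flat over `O` (B4b)
    rw [show s.ker.comap τ₁ ⊔ strictTransformIdeal τ₁ s.ker K₀ = strictTransformIdeal τ₁ s.ker K₀ ⊔ s.ker.comap τ₁ from sup_comm _ _]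
    simpa only [Category.assoc] using hflat
  · -- (iii) `E` is locally principal (an effective Cartier divisor)
    obtain ⟨g₀, -, hg₀⟩ := hτ₁.isEffectiveCartier.exists_stalkIdeal_eq_span z
    exact ⟨⟨g₀, hg₀⟩⟩
  · -- (iii) the cone is principal at every point (res-D-pv-032, p529806)
    exact isPrincipal_stalkIdeal_strictTransformIdeal hX'reg hsreg hτ₁ hs0 K₀ hK₀pr z
  · -- (iv) off the generic points of `Y` (B4b support + `hsoff`)
    rintro _ ⟨z, hz, rfl⟩
    rw [show s.ker.comap τ₁ ⊔ strictTransformIdeal τ₁ s.ker K₀ = strictTransformIdeal τ₁ s.ker K₀ ⊔ s.ker.comap τ₁ from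
      sup_comm _ _] at hz
    have hzE : τ₁ z ∈ (s.ker.support : Set X') := by
      have h := hsuppE hz
      rw [SetLike.mem_coe, Scheme.IdealSheafData.support_comap] at h
      exact h
    rw [Scheme.Hom.comp_apply]
    exact hsoff _ hzE
  · -- (v) off the `S`-points: the special point comes from `F₂`, lies off `y′ '' S`, and reads on a good chart (D3d)
    have hzp : τ₁ z = j x := by
      have hzq' : (τ₁ ≫ σ' ≫ q) z = IsLocalRing.closedPoint O := by simpa only [Category.assoc] using hzq
      have hz' : z ∈ ((strictTransformIdeal τ₁ s.ker K₀ ⊔ s.ker.comap τ₁).support : Set X₁) := by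
        rwa [show s.ker.comap τ₁ ⊔ strictTransformIdeal τ₁ s.ker K₀ = strictTransformIdeal τ₁ s.ker K₀ ⊔ s.ker.comap τ₁ from
          sup_comm _ _] at hz
      rw [← hsx]
      exact support_carrierDelta_inter_preimage_closedPoint_subset O (σ' ≫ q) s hs τ₁ K₀ ⟨hz', hzq'⟩
    have hzr : z ∈ Set.range j₂ := by
      rw [range_eq_preimage_of_isPullback hsq₂', range_specMap_of_surjective_of_field θ hθ]
      exact (by simpa only [Category.assoc] using hzq : (τ₁ ≫ σ' ≫ q) z = IsLocalRing.closedPoint O)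
    obtain ⟨w, rfl⟩ := hzr
    have hw : υ w = x := by
      apply (j.isClosedEmbedding).injective
      rw [← Scheme.Hom.comp_apply, ← hcomm, Scheme.Hom.comp_apply]; exact hzp
    have hwS : ∀ t ∈ S, w ≠ y' t := by
      rintro t ht rfl
      exact hzex ⟨y' t, ⟨t, ht, rfl⟩, rfl⟩
    obtain ⟨l, 𝔔d, χd, hχd, hlocd, h𝔔d, hgood⟩ := exists_goodChart_of_forall_ne_clusterPoint hx hυ
      (fun i => (j.stalkMap x).hom (c i)) hcb𝔪 πk hkerπ i (fun t l => πO (aO t l)) hF.2.1 y' hy'x 𝔮p χp hχp hlocp h𝔮p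
      (fun t l => (j.stalkMap x).hom (((Scheme.ΓSpecIso (.of O)).inv ≫ (σ' ≫ q).appTop ≫ X'.presheaf.Γgerm (j x)).hom (aO t l)))
      (fun t l => hπO (aO t l)) hfrp S w hw hwS
    -- the excluded members on the chart `l`, with `O`-lifts of their coordinates
    obtain ⟨bO, hbO⟩ : ∃ bO : {t : Fin ns // (if h : l = i t then (1 : k') else πO (aO t ⟨l, h⟩)) ≠ 0 ∧ (t ∈ S ∨ i t ≠ l)} →
        {l' : Fin 3 // l' ≠ l} → O, ∀ e l', πO (bO e l') =
          (if h : (l' : Fin 3) = i e.1 then (1 : k') else πO (aO e.1 ⟨l', h⟩)) /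
            (if h : l = i e.1 then (1 : k') else πO (aO e.1 ⟨l, h⟩)) :=
      ⟨fun e l' => (hπOsurj _).choose, fun e l' => (hπOsurj _).choose_spec⟩
    have hnot : ∀ e : {t : Fin ns // (if h : l = i t then (1 : k') else πO (aO t ⟨l, h⟩)) ≠ 0 ∧ (t ∈ S ∨ i t ≠ l)},
        ¬ ∀ l' : {l' : Fin 3 // l' ≠ l}, blowupAlgebra.frac (fun i => (j.stalkMap x).hom (c i)) l l'.1 -
          algebraMap _ _ ((j.stalkMap x).hom (((Scheme.ΓSpecIso (.of O)).inv ≫ (σ' ≫ q).appTop ≫ X'.presheaf.Γgerm (j x)).hom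
            (bO e l'))) ∈ 𝔔d.asIdeal :=
      fun e => hgood e.1 e.2.1 e.2.2 _ fun l' => by rw [hπO]; exact hbO e l'
    have h := isRegularLocalRing_quotient_carrierDelta_of_goodChart k O θ hθ (σ' ≫ q) s hs j t hsq x hx hsx τ₁ hτ₁ υ hυ j₂ hcomm
      hcarrier c hcI hqr θR hθR ϖ hϖ h𝔪 Φ hΦd hΦι K₀ hK₀ w hw l 𝔔d χd hχd hlocd bO hnot
      (deltaClause_pointed_of_comap_ne πO ϖ i aO S l (dehomogenize l Φ) (hΔ l) bO hbO) hz
    exact ⟨h.1, fun _ => h.2⟩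
  · -- (vi) the centred packages at the points of `S` (res-L1-w45b-stub-3's D4)
    obtain ⟨t, ht, rfl⟩ := hy₀
    exact hpkg t ht

end Summit.ResolutionOfSingularities.ResolutionOfSingularities.Cruxes.EquisingularLiftNat.Sections

end
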